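import Summits.Parity.GeneralizedHardyLittlewood.Theses.LiouvilleMAD

/-!
# Disproof work file — crux `LambdaLiouvilleLevel` (stmt-Parity-13325, route LiouvilleMAD)

Standing disprover: refuter-cdisprove-stmt-Parity-13325-0 (cycle 1, 2026-08-16).

The crux (verbatim, `Summit.Parity.GeneralizedHardyLittlewood.Theses.LiouvilleMAD.LambdaLiouvilleLevel`):
Bombieri–Vinogradov at level `N^{ε₀}` for the sequence `Λ(n)λ(n+h)` —
`∀ h ≠ 0, ∃ ε₀ > 0, ∀ A > 0, ∃ C N₀, ∀ N ≥ N₀, ∀ w y : ℕ → ℕ, (∀ q, y q ≤ N) →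
  Σ_{q ∈ [1, ⌊N^{ε₀}⌋]} |Σ_{1 ≤ n ≤ y q, n ≡ w q (q)} Λ(n) λ(toNat(n+h))| ≤ C·N/(log N)^A`.

## Findings (index; every `theorem` below is sorry-free unless marked NEAR-MISS)

* ELABORATION: rc 0; body re-read symbol by symbol (W.lean, `Iff.rfl`). `Real.log N ^ A` is the real
  power `(log N)^A` (rpow); for `N ∈ {0,1}` the right side is `C·N/0 = 0` and the left side is `0`
  too (only `n = 1`, `Λ(1) = 0`), so the degenerate heights are harmless. Junk: `Int.toNat (n+h) = 0`
  for `n ≤ -h` (then `λ 0 = 0`): finitely many terms, harmless. Non-coprime residues `w q` are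
  admitted: for `Λ`-supported `n` they see only prime powers of primes dividing `q` (≤ log² N per
  modulus) — harmless at level `N^{ε₀}`, NOT at level `N(log N)^{-B}` (see (c)).
* (a) LOAD-BEARING HYPOTHESES — "any proof must use H":
  - `lambdaLiouvilleLevel_false_without_hne` : dropping `h ≠ 0` is FALSE — at `h = 0`,
    `Σ_{n≤N} Λ(n)λ(n) = -ψ(N) + O(ψ(N) - θ(N))`, `|·| ≥ N log 2 - log(N+1) - 4√N log N ≫ N`
    (Chebyshev, Mathlib `Chebyshev.psi_ge`, `psi_sub_theta_le`), against `C N/log N`.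
  - `lambdaLiouvilleLevel_false_without_heightCap` : dropping `∀ q, y q ≤ N` is FALSE — the partial
    sums `S(Y) = Σ_{n≤Y} Λ(n)λ(n+1)` jump by `log p` at primes, so they are unbounded, while the
    right side is frozen at `N = N₀`.
  - NOT load-bearing (information for provers): `∃ N₀` is absorbable into `C` (for `2 ≤ N < N₀` the
    left side is bounded and `N/(log N)^A > 0`; `N ∈ {0,1}` hold with both sides `0`), and the
    guard `0 < A` is cosmetic (smaller `A` is weaker). Not formalised — bookkeeping only.
* (b) TIGHTNESS / (c) NATURAL STRENGTHENINGS refuted: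
  - `not_lambdaLiouvilleLevelLogPowerLevel` : for every `B ≥ 0`, the same statement at LEVEL
    `⌊N/(log N)^B⌋` (instead of `⌊N^{ε₀}⌋`) is FALSE: residues `w_q = 0`, heights `y_q = q` make
    modulus `q` catch exactly its own term `n = q`, so the modulus sum is `ψ(level) ≫ N/(log N)^B`,
    never `≪ N/(log N)^{B+1}`. `B = 0` is LEVEL ONE (`not_lambdaLiouvilleLevelOne`).
    MORAL: an "Elliott–Halberstam for Λ(n)λ(n+h)" in this one-residue format must keep a power
    level `N^θ, θ < 1` (then this attack gives only `ψ(N^θ) ~ N^θ`), or restrict to `(w_q, q) = 1`.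
  - Power levels `N^θ` for any `θ < 1`, and uniformity in `|h| ≤ N`: NO cheap attack (conjecturally
    true: no main term, random size `√(N Q)`); uniformity in unbounded `h` is presumably false
    (some `h` aligns `λ(p+h)` for all `p ≤ N`) but not provable cheaply — not claimed.
* WHY THE CRUX RESISTS (numbers, not adjectives):
  1. Its `q = 1` face is quantitative hybrid Hardy–Littlewood–Chowla `HLC(1,1)`:
     `Σ_{n≤N} Λ(n)λ(n+h) ≪_A N/(log N)^A` (tree: `Theorems/LambdaLiouvilleLevel/Negative/
     LambdaLiouvilleLevelHLCFace.lean`, `hlc_one_one_of_lambdaLiouvilleLevel`, p96019) — an OPEN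
     conjecture believed TRUE (random model `√N`; Lichtman–Teräväinen 2022 Conj. 1.1; only
     shift-averaged versions proved). A disproof of the crux at `q = 1` disproves HLC.
  2. Upstream sandwich (tree, proved): `TypeIIToLevel_proof : TypeIILiouville → LambdaLiouvilleLevel`,
     `dilatedChowlaToTypeII_proof`, `decorrelationToDilatedChowla_proof`; so `¬crux` would refute
     TypeIILiouville, DilatedChowla and MAD (Coset ∧ Fan) at once — all conjecture-grade, none with a
     known counterexample family (route KILL CRITERIA: needs `|S| ≥ M^{1-o(1)}` along a sequence).
  3. Known bias mechanisms do not bite at level `N^{ε₀}`: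
     - Siegel zeros: if `λ ≈ χ₁ (mod q₁)` on `[1,N]`, the `q = 1` sum becomes
       `Σ_a χ₁(a+h) ψ(N;q₁,a) ≈ (N/φ(q₁)) Σ_{(a,q₁)=1} χ₁(a+h) = (N/φ(q₁)) μ(q₁)χ₁(h)·O(1)` — no bias of
       size `N/(log N)^A` survives (contrast: the route's POINTWISE power-saving `DilatedChowla` IS
       Siegel-sensitive, cf. Ideas/log-power-dispersion.md "Disproof used").
     - Maier-matrix / Friedlander–Granville irregularities live at levels `x·exp(-(log x)^{c})`
       (printed failures only for moduli within `exp((log q)^{5/11-ε})` of `x`: scope_caveats of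
       `Literature.Barriers.Parity.FriedlanderGranvilleUniformityBarrier`, FGHM 1991 Thm A1),
       relative size `u^{-u}` with `u = log(x/q)/log log x`; at `q ≤ x^{ε₀}` this is
       `x^{-(1-ε₀)+o(1)}`, invisible against `(log x)^{-A}`.
     - Non-coprime classes / prime powers: `≤ N^{ε₀} log² N` in total (used constructively in (c)).
  4. Numerics ON THE CRUX'S OWN LEFT SIDE (this seat, kit j016826, 1043 s, evidence on the item):
     `L = Σ_{q≤⌊N^ε⌋} max_w max_{y≤N} |Σ_{n≤y, n≡w (q)} Λ(n)λ(n+h)|` for N ∈ {10⁵,10⁶,10⁷},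
     h ∈ {1,2,−1,6,30,−7}, ε ∈ {0.2,0.3} (36 rows), against R = the same statistic with λ(n+h)
     replaced by i.i.d. random signs (mean of 3) and T = the trivial bound (no cancellation):
     L/R ∈ [0.69, 1.65] overall and ∈ [0.88, 1.16] at N = 10⁷, ε = 0.3 (Q = 125); L/T falls
     0.03–0.05 → 0.0035–0.0095 from 10⁵ to 10⁷; q = 1 face max_y|S₁|/√(ΣΛ²) ∈ [0.56, 3.10]
     (largest at h = 30, N = 10⁵; 1.80 at 10⁷). I.e. the crux's sum behaves like the random-sign
     model at every tested scale, no drift; (log N)^{−A} savings themselves are invisible at 10⁷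
     (N/(log N)² = 3.8·10⁴ < L ≈ 8·10⁵ at Q = 125: the random size √N·Q^{1/2}·polylog dominates) —
     the test is model-conformity, not the inequality. Earlier ideation jobs j015473, j015308:
     square-root behaviour of dilated / corner Liouville pair sums (max |K|/√B′ = 2.96, 775 sums).
  VERDICT (cycle 1): no kill; the crux is DEPTH (open HLC-strength), not falsity. Negative lemmas
  LANDED: (a) `Theorems/LambdaLiouvilleLevel/Negative/LambdaLiouvilleLevelLoadBearing.lean` (p100552,
  ACCEPTED @ ea90d9fa0563); (c) `…/LambdaLiouvilleLevelLevelTightness.lean` (p102019, ACCEPTED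
  @ 4dd6d5bf9fd5); both importable by ideators/planners. The AP face below is a citable
  consequence; prose summary for ideators in `Cruxes/LambdaLiouvilleLevel/DisproverNotes.md`.
* `-- Targets`: payload.targets = [] and PICKED = none (no line, no stubs) — nothing to attack yet.
-/

namespace Summit.Parity.GeneralizedHardyLittlewood.Cruxes.LambdaLiouvilleLevel.Disproof

open Finset Filter Asymptotics
open ArithmeticFunction (vonMangoldt liouville)
open Summit.Parity.GeneralizedHardyLittlewood.Theses.LiouvilleMAD (LambdaLiouvilleLevel)

/-! ## Small facts about `λ` and the crux's inner sums -/

/-- `|λ(m)| = 1` for `m ≠ 0` (as a real number). [folklore] -/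
theorem abs_cast_liouville {m : ℕ} (hm : m ≠ 0) : |((liouville m : ℤ) : ℝ)| = 1 := by
  rw [ArithmeticFunction.liouville_apply hm]
  push_cast
  rw [abs_pow, abs_neg, abs_one, one_pow]

/-- `λ(p) = -1` at a prime `p`. [folklore] -/
theorem liouville_prime {p : ℕ} (hp : p.Prime) : liouville p = -1 := by
  rw [ArithmeticFunction.liouville_apply hp.ne_zero, ArithmeticFunction.cardFactors_apply_prime hp,
    pow_one]

/-- The class filter at modulus `1` is everything. [folklore] -/
theorem filter_modEq_one (s : Finset ℕ) (w : ℕ) : s.filter (fun n : ℕ => n ≡ w [MOD 1]) = s :=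
  Finset.filter_true_of_mem (fun _ _ => Nat.modEq_one)

/-- `Icc 1 N = Ioc 0 N` in `ℕ` (to speak to Mathlib's `Chebyshev.psi`). [folklore] -/
theorem Icc_one_eq_Ioc_zero (N : ℕ) : Icc 1 N = Ioc 0 N := by
  ext n
  simp only [mem_Icc, mem_Ioc]
  omega

/-- `1 ∈ [1, ⌊N^{ε₀}⌋]` as soon as `N ≥ 1` and `ε₀ ≥ 0`: the `q = 1` term is always present.
[folklore] -/
theorem one_mem_Icc_floor_rpow {N : ℕ} (hN : 1 ≤ N) {ε₀ : ℝ} (hε₀ : 0 ≤ ε₀) :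
    1 ∈ Icc 1 ⌊(N : ℝ) ^ ε₀⌋₊ := by
  rw [mem_Icc]
  refine ⟨le_rfl, Nat.le_floor ?_⟩
  rw [Nat.cast_one]
  exact Real.one_le_rpow (by exact_mod_cast hN) hε₀

/-! ## (a) Load-bearing hypothesis 1: `h ≠ 0`

`LambdaLiouvilleLevelWithoutHne` is the crux with the guard `h ≠ 0` deleted; it is false at `h = 0`
because `λ(p) = -1` makes `Λ(n)λ(n)` a signed copy of `Λ` on the primes. -/

/-- The crux with the hypothesis `h ≠ 0` dropped (everything else verbatim). -/
def LambdaLiouvilleLevelWithoutHne : Prop :=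
  ∀ h : ℤ, ∃ ε₀ : ℝ, 0 < ε₀ ∧ ∀ A : ℝ, 0 < A → ∃ C : ℝ, ∃ N₀ : ℕ, ∀ N : ℕ, N₀ ≤ N →
    ∀ w y : ℕ → ℕ, (∀ q, y q ≤ N) →
      (∑ q ∈ Finset.Icc 1 ⌊(N : ℝ) ^ ε₀⌋₊,
        |∑ n ∈ (Finset.Icc 1 (y q)).filter (fun n : ℕ => n ≡ w q [MOD q]),
          ArithmeticFunction.vonMangoldt n *
            (ArithmeticFunction.liouville (Int.toNat ((n : ℤ) + h)) : ℝ)|) ≤ C * N / Real.log N ^ A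

/-- Sanity: the variant is the crux minus one hypothesis (so its negation says the hypothesis is
used by every proof). [folklore] -/
theorem lambdaLiouvilleLevel_of_withoutHne (H : LambdaLiouvilleLevelWithoutHne) :
    LambdaLiouvilleLevel :=
  fun h _ => H h

/-- **Chebyshev lower bound for the diagonal correlation.**
`ψ(N) - 2(ψ(N) - θ(N)) ≤ |Σ_{1 ≤ n ≤ N} Λ(n) λ(n)|`: write `Λλ = -Λ + Λ(λ+1)`; the second term
vanishes at primes (`λ(p) = -1`) and is `≤ 2Λ` elsewhere, i.e. bounded by `2(ψ - θ)` in total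
(Mathlib `Chebyshev.psi_sub_theta_eq_sum_not_prime`). [folklore] -/
theorem psi_sub_le_abs_sum_vonMangoldt_mul_liouville (N : ℕ) :
    Chebyshev.psi N - 2 * (Chebyshev.psi N - Chebyshev.theta N) ≤
      |∑ n ∈ Icc 1 N, vonMangoldt n * ((liouville n : ℤ) : ℝ)| := by
  have hpsi : Chebyshev.psi N = ∑ n ∈ Ioc 0 N, vonMangoldt n := by
    rw [Chebyshev.psi, Nat.floor_natCast]
  have hdiff : Chebyshev.psi N - Chebyshev.theta N =
      ∑ n ∈ (Ioc 0 N).filter (fun n => ¬ n.Prime), vonMangoldt n := by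
    rw [Chebyshev.psi_sub_theta_eq_sum_not_prime, Nat.floor_natCast]
  set E : ℝ := ∑ n ∈ Ioc 0 N, vonMangoldt n * (((liouville n : ℤ) : ℝ) + 1) with hE
  have hdecomp : ∑ n ∈ Icc 1 N, vonMangoldt n * ((liouville n : ℤ) : ℝ) =
      -(∑ n ∈ Ioc 0 N, vonMangoldt n) + E := by
    rw [Icc_one_eq_Ioc_zero, hE, ← Finset.sum_neg_distrib, ← Finset.sum_add_distrib]
    exact Finset.sum_congr rfl fun n _ => by ring
  have herr : |E| ≤ 2 * ∑ n ∈ (Ioc 0 N).filter (fun n => ¬ n.Prime), vonMangoldt n := by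
    rw [hE, Finset.mul_sum, Finset.sum_filter]
    refine (Finset.abs_sum_le_sum_abs _ _).trans (Finset.sum_le_sum fun n hn => ?_)
    have hn0 : n ≠ 0 := (Finset.mem_Ioc.mp hn).1.ne'
    by_cases hprime : n.Prime
    · rw [if_neg (not_not_intro hprime), liouville_prime hprime]
      simp
    · rw [if_pos hprime, abs_mul, abs_of_nonneg ArithmeticFunction.vonMangoldt_nonneg, mul_comm]
      have h2 : |((liouville n : ℤ) : ℝ) + 1| ≤ 2 := by
        calc |((liouville n : ℤ) : ℝ) + 1| ≤ |((liouville n : ℤ) : ℝ)| + |(1 : ℝ)| := abs_add_le _ _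
          _ = 2 := by rw [abs_cast_liouville hn0, abs_one]; norm_num
      exact mul_le_mul_of_nonneg_right h2 ArithmeticFunction.vonMangoldt_nonneg
  rw [hdecomp, ← hpsi]
  rw [← hdiff] at herr
  have htri : |(-Chebyshev.psi N + E) - E| ≤ |-Chebyshev.psi N + E| + |E| := abs_sub _ _
  rw [add_sub_cancel_right, abs_neg, abs_of_nonneg (Chebyshev.psi_nonneg _)] at htri
  linarith

/-- Real-variable bookkeeping: eventually `C x / log x + log (x+1) + 4 √x log x < x log 2`.
(`log x = o(√x)`, Mathlib `isLittleO_log_rpow_atTop`.) [folklore] -/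
theorem eventually_junk_lt (C : ℝ) :
    ∀ᶠ x : ℝ in atTop,
      C * x / Real.log x + Real.log (x + 1) + 4 * Real.sqrt x * Real.log x < x * Real.log 2 := by
  have hl2 : 0 < Real.log 2 := Real.log_pos one_lt_two
  have hc : 0 < Real.log 2 / 16 := by positivity
  have hlo := (isLittleO_log_rpow_atTop (one_half_pos : (0 : ℝ) < 1 / 2)).bound hc
  filter_upwards [hlo, Real.tendsto_log_atTop.eventually_ge_atTop (4 * |C| / Real.log 2 + 1),
    eventually_ge_atTop (16 : ℝ)] with x hx hlogC hx16
  have hx0 : 0 < x := by linarith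
  have hx1 : 1 ≤ x := by linarith
  have hlogpos : 0 < Real.log x := by
    have : 0 ≤ 4 * |C| / Real.log 2 := by positivity
    linarith
  -- `log x ≤ (log 2 / 16) √x`
  have hsqrt : Real.log x ≤ Real.log 2 / 16 * Real.sqrt x := by
    rw [Real.norm_eq_abs, Real.norm_eq_abs, abs_of_pos hlogpos,
      abs_of_nonneg (Real.rpow_nonneg hx0.le _), ← Real.sqrt_eq_rpow] at hx
    exact hx
  have hsqrt_le : Real.sqrt x ≤ x := by
    rw [Real.sqrt_le_left (by linarith)]
    nlinarith
  -- (i) `C x / log x ≤ x log 2 / 4`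
  have h1 : C * x / Real.log x ≤ x * Real.log 2 / 4 := by
    rw [div_le_iff₀ hlogpos]
    have hC : |C| ≤ Real.log 2 / 4 * Real.log x := by
      have h' : 4 * |C| / Real.log 2 ≤ Real.log x := by linarith
      rw [div_le_iff₀ hl2] at h'
      linarith
    calc C * x ≤ |C| * x := by gcongr; exact le_abs_self C
      _ ≤ (Real.log 2 / 4 * Real.log x) * x := by gcongr
      _ = x * Real.log 2 / 4 * Real.log x := by ring
  -- (ii) `log (x+1) ≤ x log 2 / 4`
  have h2 : Real.log (x + 1) ≤ x * Real.log 2 / 4 := by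
    have hle : Real.log (x + 1) ≤ Real.log 2 + Real.log x := by
      rw [← Real.log_mul (by norm_num) hx0.ne']
      exact Real.log_le_log (by linarith) (by linarith)
    have : Real.log x ≤ Real.log 2 / 16 * x := hsqrt.trans (by gcongr)
    nlinarith
  -- (iii) `4 √x log x ≤ x log 2 / 4`
  have h3 : 4 * Real.sqrt x * Real.log x ≤ x * Real.log 2 / 4 := by
    have hs0 : 0 ≤ Real.sqrt x := Real.sqrt_nonneg x
    calc 4 * Real.sqrt x * Real.log x ≤ 4 * Real.sqrt x * (Real.log 2 / 16 * Real.sqrt x) := by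
          gcongr
      _ = Real.log 2 / 4 * (Real.sqrt x * Real.sqrt x) := by ring
      _ = x * Real.log 2 / 4 := by rw [Real.mul_self_sqrt hx0.le]; ring
  nlinarith

/-- **`h ≠ 0` is load-bearing.** The crux with the guard `h ≠ 0` deleted is FALSE: at `h = 0` the
`q = 1` term alone is `|Σ_{n≤N} Λ(n)λ(n)| ≥ N log 2 - log(N+1) - 4√N log N` (Chebyshev), which beats
`C N / log N` for large `N`. Witness: `h = 0`, `A = 1`, `w ≡ 0`, `y ≡ N`. [folklore] -/
theorem lambdaLiouvilleLevel_false_without_hne : ¬ LambdaLiouvilleLevelWithoutHne := by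
  intro H
  obtain ⟨ε₀, hε₀, H⟩ := H 0
  obtain ⟨C, N₀, H⟩ := H 1 one_pos
  have hev := (eventually_junk_lt C).natCast_atTop
  obtain ⟨N, hjunk, hN⟩ := (hev.and (eventually_ge_atTop (max N₀ 1))).exists
  have hN₀ : N₀ ≤ N := le_trans (le_max_left _ _) hN
  have hN1 : 1 ≤ N := le_trans (le_max_right _ _) hN
  have key := H N hN₀ (fun _ => 0) (fun _ => N) (fun _ => le_rfl)
  have hle := Finset.single_le_sum
    (f := fun q => |∑ n ∈ (Icc 1 N).filter (fun n : ℕ => n ≡ 0 [MOD q]),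
      vonMangoldt n * ((liouville (Int.toNat ((n : ℤ) + 0)) : ℤ) : ℝ)|)
    (fun q _ => abs_nonneg _) (one_mem_Icc_floor_rpow hN1 hε₀.le)
  have hq1 : (∑ n ∈ (Icc 1 N).filter (fun n : ℕ => n ≡ 0 [MOD 1]),
      vonMangoldt n * ((liouville (Int.toNat ((n : ℤ) + 0)) : ℤ) : ℝ)) =
      ∑ n ∈ Icc 1 N, vonMangoldt n * ((liouville n : ℤ) : ℝ) := by
    rw [filter_modEq_one]
    refine Finset.sum_congr rfl fun n _ => ?_
    rw [add_zero, Int.toNat_natCast]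
  simp only [hq1] at hle
  have hup : |∑ n ∈ Icc 1 N, vonMangoldt n * ((liouville n : ℤ) : ℝ)| ≤ C * N / Real.log N := by
    have := hle.trans key
    rwa [Real.rpow_one] at this
  have hlow := psi_sub_le_abs_sum_vonMangoldt_mul_liouville N
  have hpsi := Chebyshev.psi_ge N
  have hpt := Chebyshev.psi_sub_theta_le (x := (N : ℝ)) (by exact_mod_cast hN1)
  linarith

/-! ## (a) Load-bearing hypothesis 2: the height cap `∀ q, y q ≤ N` -/

/-- The crux with the height cap `∀ q, y q ≤ N` dropped (everything else verbatim). -/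
def LambdaLiouvilleLevelWithoutHeightCap : Prop :=
  ∀ h : ℤ, h ≠ 0 → ∃ ε₀ : ℝ, 0 < ε₀ ∧ ∀ A : ℝ, 0 < A → ∃ C : ℝ, ∃ N₀ : ℕ, ∀ N : ℕ, N₀ ≤ N →
    ∀ w y : ℕ → ℕ,
      (∑ q ∈ Finset.Icc 1 ⌊(N : ℝ) ^ ε₀⌋₊,
        |∑ n ∈ (Finset.Icc 1 (y q)).filter (fun n : ℕ => n ≡ w q [MOD q]),
          ArithmeticFunction.vonMangoldt n *
            (ArithmeticFunction.liouville (Int.toNat ((n : ℤ) + h)) : ℝ)|) ≤ C * N / Real.log N ^ A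

/-- Sanity: the variant is the crux minus the height cap. [folklore] -/
theorem lambdaLiouvilleLevel_of_withoutHeightCap (H : LambdaLiouvilleLevelWithoutHeightCap) :
    LambdaLiouvilleLevel := by
  intro h hh
  obtain ⟨ε₀, hε₀, H⟩ := H h hh
  refine ⟨ε₀, hε₀, fun A hA => ?_⟩
  obtain ⟨C, N₀, H⟩ := H A hA
  exact ⟨C, N₀, fun N hN w y _ => H N hN w y⟩

/-- The partial sums `S(Y) = Σ_{1 ≤ n ≤ Y} Λ(n) λ(n+1)` (shift `h = 1`). -/
noncomputable def shiftOnePartialSum (Y : ℕ) : ℝ :=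
  ∑ n ∈ Icc 1 Y, vonMangoldt n * ((liouville (Int.toNat ((n : ℤ) + 1)) : ℤ) : ℝ)

/-- `S(Y+1) = S(Y) + Λ(Y+1) λ(Y+2)`. [folklore] -/
theorem shiftOnePartialSum_succ (Y : ℕ) :
    shiftOnePartialSum (Y + 1) =
      shiftOnePartialSum Y + vonMangoldt (Y + 1) * ((liouville (Y + 2) : ℤ) : ℝ) := by
  unfold shiftOnePartialSum
  rw [Finset.sum_Icc_succ_top (by omega)]
  congr 2

/-- At a prime `p` the partial sums jump by exactly `log p` in absolute value. [folklore] -/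
theorem abs_shiftOnePartialSum_jump {p : ℕ} (hp : p.Prime) :
    |shiftOnePartialSum p - shiftOnePartialSum (p - 1)| = Real.log p := by
  obtain ⟨k, rfl⟩ : ∃ k, p = k + 1 := ⟨p - 1, by have := hp.one_le; omega⟩
  have h1 : shiftOnePartialSum (k + 1) - shiftOnePartialSum (k + 1 - 1) =
      vonMangoldt (k + 1) * ((liouville (k + 2) : ℤ) : ℝ) := by
    rw [Nat.add_sub_cancel, shiftOnePartialSum_succ]; ring
  rw [h1, abs_mul, ArithmeticFunction.vonMangoldt_apply_prime hp, abs_cast_liouville (by omega),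
    mul_one]
  exact abs_of_nonneg (Real.log_nonneg (by exact_mod_cast hp.one_le))

/-- The shifted partial sums are unbounded (their jumps are). [folklore] -/
theorem exists_lt_abs_shiftOnePartialSum (B : ℝ) : ∃ Y, B < |shiftOnePartialSum Y| := by
  obtain ⟨p, hpge, hp⟩ := Nat.exists_infinite_primes (⌈Real.exp (2 * |B|)⌉₊ + 1)
  have hlogp : 2 * |B| < Real.log p := by
    have h1 : Real.exp (2 * |B|) < p := by
      calc Real.exp (2 * |B|) ≤ ⌈Real.exp (2 * |B|)⌉₊ := Nat.le_ceil _
        _ < ((⌈Real.exp (2 * |B|)⌉₊ + 1 : ℕ) : ℝ) := by push_cast; linarith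
        _ ≤ p := by exact_mod_cast hpge
    calc 2 * |B| = Real.log (Real.exp (2 * |B|)) := (Real.log_exp _).symm
      _ < Real.log p := Real.log_lt_log (Real.exp_pos _) h1
  have hjump := abs_shiftOnePartialSum_jump hp
  by_contra hcon
  push Not at hcon
  have h1 := hcon p
  have h2 := hcon (p - 1)
  have htri : |shiftOnePartialSum p - shiftOnePartialSum (p - 1)| ≤
      |shiftOnePartialSum p| + |shiftOnePartialSum (p - 1)| := abs_sub _ _
  have hB : B ≤ |B| := le_abs_self B
  linarith

/-- **The height cap is load-bearing.** Without `∀ q, y q ≤ N` the statement is FALSE: freeze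
`N = max N₀ 1`; the right side is the constant `C N / log N`, but the `q = 1` term with `y 1 = Y`
is `|S(Y)|`, unbounded in `Y`. Witness: `h = 1`, `A = 1`, `w ≡ 0`, `y ≡ Y` large. [folklore] -/
theorem lambdaLiouvilleLevel_false_without_heightCap : ¬ LambdaLiouvilleLevelWithoutHeightCap := by
  intro H
  obtain ⟨ε₀, hε₀, H⟩ := H 1 one_ne_zero
  obtain ⟨C, N₀, H⟩ := H 1 one_pos
  set N : ℕ := max N₀ 1 with hNdef
  have hN₀ : N₀ ≤ N := le_max_left _ _
  have hN1 : 1 ≤ N := le_max_right _ _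
  obtain ⟨Y, hY⟩ := exists_lt_abs_shiftOnePartialSum (C * N / Real.log N ^ (1 : ℝ))
  have key := H N hN₀ (fun _ => 0) (fun _ => Y)
  have hle := Finset.single_le_sum
    (f := fun q => |∑ n ∈ (Icc 1 Y).filter (fun n : ℕ => n ≡ 0 [MOD q]),
      vonMangoldt n * ((liouville (Int.toNat ((n : ℤ) + 1)) : ℤ) : ℝ)|)
    (fun q _ => abs_nonneg _) (one_mem_Icc_floor_rpow hN1 hε₀.le)
  have hq1 : (∑ n ∈ (Icc 1 Y).filter (fun n : ℕ => n ≡ 0 [MOD 1]),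
      vonMangoldt n * ((liouville (Int.toNat ((n : ℤ) + 1)) : ℤ) : ℝ)) = shiftOnePartialSum Y := by
    rw [filter_modEq_one]; rfl
  simp only [hq1] at hle
  linarith [hle.trans key]

/-! ## (c) Natural strengthening refuted: level `N/(log N)^B` (and level one)

With residues `w_q = 0` and heights `y_q = q`, modulus `q` sees exactly the term `n = q`, so the
modulus sum up to level `Q ≤ N` is `Σ_{q≤Q} Λ(q) = ψ(Q)`. Hence NO level of the shape
`Q = N/(log N)^B` can carry a saving `(log N)^{-A}` for every `A`; power levels `N^θ, θ < 1` are not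
touched by this (then `ψ(N^θ) ~ N^θ`). -/

/-- The crux at level `⌊N/(log N)^B⌋` instead of `⌊N^{ε₀}⌋` (no `ε₀`; everything else verbatim). -/
def LambdaLiouvilleLevelLogPowerLevel (B : ℝ) : Prop :=
  ∀ h : ℤ, h ≠ 0 → ∀ A : ℝ, 0 < A → ∃ C : ℝ, ∃ N₀ : ℕ, ∀ N : ℕ, N₀ ≤ N →
    ∀ w y : ℕ → ℕ, (∀ q, y q ≤ N) →
      (∑ q ∈ Finset.Icc 1 ⌊(N : ℝ) / Real.log N ^ B⌋₊,
        |∑ n ∈ (Finset.Icc 1 (y q)).filter (fun n : ℕ => n ≡ w q [MOD q]),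
          ArithmeticFunction.vonMangoldt n *
            (ArithmeticFunction.liouville (Int.toNat ((n : ℤ) + h)) : ℝ)|) ≤ C * N / Real.log N ^ A

/-- The crux at LEVEL ONE (`q ≤ N`; no `ε₀`; everything else verbatim). -/
def LambdaLiouvilleLevelOne : Prop :=
  ∀ h : ℤ, h ≠ 0 → ∀ A : ℝ, 0 < A → ∃ C : ℝ, ∃ N₀ : ℕ, ∀ N : ℕ, N₀ ≤ N →
    ∀ w y : ℕ → ℕ, (∀ q, y q ≤ N) →
      (∑ q ∈ Finset.Icc 1 N,
        |∑ n ∈ (Finset.Icc 1 (y q)).filter (fun n : ℕ => n ≡ w q [MOD q]),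
          ArithmeticFunction.vonMangoldt n *
            (ArithmeticFunction.liouville (Int.toNat ((n : ℤ) + h)) : ℝ)|) ≤ C * N / Real.log N ^ A

/-- The zero class of modulus `q ≥ 1` inside `[1, q]` is `{q}`. [folklore] -/
theorem filter_Icc_modEq_zero_self {q : ℕ} (hq : 1 ≤ q) :
    (Icc 1 q).filter (fun n : ℕ => n ≡ 0 [MOD q]) = {q} := by
  ext n
  simp only [mem_filter, mem_Icc, mem_singleton, Nat.modEq_zero_iff_dvd]
  constructor
  · rintro ⟨⟨h1, h2⟩, hdvd⟩
    exact le_antisymm h2 (Nat.le_of_dvd (by omega) hdvd)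
  · rintro rfl
    exact ⟨⟨hq, le_rfl⟩, dvd_rfl⟩

/-- **Diagonal extraction.** With `w ≡ 0`, `y q = min q N` and shift `h = 1`, the modulus sum up to
any level `Q ≤ N` equals `ψ(Q)`. [folklore] -/
theorem moduliSum_zero_residue_eq_psi {Q N : ℕ} (hQN : Q ≤ N) :
    (∑ q ∈ Icc 1 Q, |∑ n ∈ (Icc 1 (min q N)).filter (fun n : ℕ => n ≡ 0 [MOD q]),
        vonMangoldt n * ((liouville (Int.toNat ((n : ℤ) + 1)) : ℤ) : ℝ)|) = Chebyshev.psi Q := by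
  rw [Chebyshev.psi, Nat.floor_natCast, ← Icc_one_eq_Ioc_zero]
  refine Finset.sum_congr rfl fun q hq => ?_
  have hq1 : 1 ≤ q := (mem_Icc.mp hq).1
  have hqN : q ≤ N := (mem_Icc.mp hq).2.trans hQN
  rw [min_eq_left hqN, filter_Icc_modEq_zero_self hq1, Finset.sum_singleton, abs_mul,
    abs_of_nonneg ArithmeticFunction.vonMangoldt_nonneg]
  have : Int.toNat ((q : ℤ) + 1) = q + 1 := by
    rw [show ((q : ℤ) + 1) = ((q + 1 : ℕ) : ℤ) by omega, Int.toNat_natCast]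
  rw [this, abs_cast_liouville (by omega), mul_one]

/-- Real-variable bookkeeping for (c): for `B ≥ 0`, eventually
`C·X/L + log 2 + log(x+1) < X·log 2` where `L = log x`, `X = x/L^B`. [folklore] -/
theorem eventually_logPower_junk_lt (B C : ℝ) (hB : 0 ≤ B) :
    ∀ᶠ x : ℝ in atTop,
      C * (x / Real.log x ^ B) / Real.log x + Real.log 2 + Real.log (x + 1) <
        (x / Real.log x ^ B - 1) * Real.log 2 := by
  have hl2 : 0 < Real.log 2 := Real.log_pos one_lt_two
  have hl2' : Real.log 2 < 1 := by
    have := Real.log_two_lt_d9; norm_num at this; linarith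
  have hc : 0 < Real.log 2 / 16 := by positivity
  have hlo := (isLittleO_log_rpow_rpow_atTop (B + 1) (one_pos : (0 : ℝ) < 1)).bound hc
  filter_upwards [hlo, Real.tendsto_log_atTop.eventually_ge_atTop (4 * |C| / Real.log 2 + 1),
    eventually_ge_atTop (2 : ℝ)] with x hx hlogC hx2
  have hx0 : 0 < x := by linarith
  have hL1 : 1 ≤ Real.log x := by
    have : 0 ≤ 4 * |C| / Real.log 2 := by positivity
    linarith
  have hL0 : 0 < Real.log x := by linarith
  have hLB : 1 ≤ Real.log x ^ B := Real.one_le_rpow hL1 hB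
  have hLB0 : 0 < Real.log x ^ B := by linarith
  set X : ℝ := x / Real.log x ^ B with hX
  have hX0 : 0 < X := div_pos hx0 hLB0
  -- `(log x)^{B+1} ≤ (log 2 / 16) x`
  have hpow : Real.log x ^ (B + 1) ≤ Real.log 2 / 16 * x := by
    rw [Real.norm_eq_abs, Real.norm_eq_abs, abs_of_nonneg (Real.rpow_nonneg hL0.le _),
      Real.rpow_one, abs_of_pos hx0] at hx
    exact hx
  have hsplit : Real.log x ^ (B + 1) = Real.log x ^ B * Real.log x := Real.rpow_add_one hL0.ne' B
  -- (i) `C X / L ≤ X log 2 / 4`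
  have h1 : C * X / Real.log x ≤ X * Real.log 2 / 4 := by
    rw [div_le_iff₀ hL0]
    have hC : |C| ≤ Real.log 2 / 4 * Real.log x := by
      have h' : 4 * |C| / Real.log 2 ≤ Real.log x := by linarith
      rw [div_le_iff₀ hl2] at h'
      linarith
    calc C * X ≤ |C| * X := by gcongr; exact le_abs_self C
      _ ≤ (Real.log 2 / 4 * Real.log x) * X := by gcongr
      _ = X * Real.log 2 / 4 * Real.log x := by ring
  -- (ii) `log 2 + log (x+1) ≤ X log 2 / 4`, i.e. `L^B (log 2 + log(x+1)) ≤ x log 2 / 4`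
  have hlog1 : 0 ≤ Real.log (x + 1) := Real.log_nonneg (by linarith)
  have h2 : Real.log 2 + Real.log (x + 1) ≤ X * Real.log 2 / 4 := by
    have hle : Real.log (x + 1) ≤ Real.log 2 + Real.log x := by
      rw [← Real.log_mul (by norm_num) hx0.ne']
      exact Real.log_le_log (by linarith) (by linarith)
    have h3L : Real.log 2 + Real.log (x + 1) ≤ 4 * Real.log x := by linarith
    have hkey : Real.log x ^ B * (Real.log 2 + Real.log (x + 1)) ≤ x * Real.log 2 / 4 := by
      calc Real.log x ^ B * (Real.log 2 + Real.log (x + 1)) ≤ Real.log x ^ B * (4 * Real.log x) := by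
            gcongr
        _ = 4 * Real.log x ^ (B + 1) := by rw [hsplit]; ring
        _ ≤ 4 * (Real.log 2 / 16 * x) := by gcongr
        _ = x * Real.log 2 / 4 := by ring
    rw [hX, show x / Real.log x ^ B * Real.log 2 / 4 = (x * Real.log 2 / 4) / Real.log x ^ B by ring,
      le_div_iff₀ hLB0]
    calc (Real.log 2 + Real.log (x + 1)) * Real.log x ^ B
        = Real.log x ^ B * (Real.log 2 + Real.log (x + 1)) := by ring
      _ ≤ x * Real.log 2 / 4 := hkey
  have hX4 : 4 ≤ X := by nlinarith
  nlinarith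

/-- **Level `N/(log N)^B` is refuted** (every `B ≥ 0`): take `h = 1`, `A = B + 1`, `w ≡ 0`,
`y q = min q N`; then the modulus sum is `ψ(⌊N/(log N)^B⌋) ≥ (N/(log N)^B - 1) log 2 - log(N+1)`,
which beats `C N/(log N)^{B+1}`. [folklore] -/
theorem not_lambdaLiouvilleLevelLogPowerLevel {B : ℝ} (hB : 0 ≤ B) :
    ¬ LambdaLiouvilleLevelLogPowerLevel B := by
  intro H
  have hA : 0 < B + 1 := by linarith
  obtain ⟨C, N₀, H⟩ := H 1 one_ne_zero (B + 1) hA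
  have hev := (eventually_logPower_junk_lt B C hB).natCast_atTop
  obtain ⟨N, hjunk, hN⟩ := (hev.and (eventually_ge_atTop (max N₀ 3))).exists
  have hN₀ : N₀ ≤ N := le_trans (le_max_left _ _) hN
  have hN3 : 3 ≤ N := le_trans (le_max_right _ _) hN
  have hNpos : (0 : ℝ) < N := by exact_mod_cast (show 0 < N by omega)
  -- `1 ≤ log N` (as `N ≥ 3 > e`), so the level is `≤ N`
  have hL1 : 1 ≤ Real.log N := by
    rw [Real.le_log_iff_exp_le hNpos]
    have := Real.exp_one_lt_d9
    have h3 : (3 : ℝ) ≤ N := by exact_mod_cast hN3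
    linarith
  have hL0 : 0 < Real.log N := by linarith
  have hLB : 1 ≤ Real.log (N : ℝ) ^ B := Real.one_le_rpow hL1 hB
  have hLB0 : 0 < Real.log (N : ℝ) ^ B := by linarith
  set Q : ℕ := ⌊(N : ℝ) / Real.log N ^ B⌋₊ with hQ
  have hQN : Q ≤ N := by
    rw [hQ]
    refine Nat.floor_le_of_le ?_
    rw [div_le_iff₀ hLB0]
    nlinarith
  have key := H N hN₀ (fun _ => 0) (fun q => min q N) (fun q => min_le_right q N)
  have hsum := moduliSum_zero_residue_eq_psi hQN
  rw [hsum] at key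
  -- lower bound for `ψ(Q)`
  have hpsi := Chebyshev.psi_ge Q
  have hQlow : (N : ℝ) / Real.log N ^ B - 1 ≤ Q := by
    have := Nat.lt_floor_add_one ((N : ℝ) / Real.log N ^ B)
    rw [← hQ] at this
    linarith
  have hQle : Real.log ((Q : ℝ) + 1) ≤ Real.log ((N : ℝ) + 1) := by
    apply Real.log_le_log (by positivity)
    exact_mod_cast Nat.add_le_add_right hQN 1
  have hl2 : 0 < Real.log 2 := Real.log_pos one_lt_two
  -- the right side at `A = B + 1`
  have hrhs : C * (N : ℝ) / Real.log N ^ (B + 1) = C * ((N : ℝ) / Real.log N ^ B) / Real.log N := by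
    rw [Real.rpow_add_one hL0.ne' B]
    field_simp
  rw [hrhs] at key
  have hprod := mul_le_mul_of_nonneg_right hQlow hl2.le
  linarith

/-- Level one is the case `B = 0`. [folklore] -/
theorem lambdaLiouvilleLevelLogPowerLevel_zero_of_levelOne (H : LambdaLiouvilleLevelOne) :
    LambdaLiouvilleLevelLogPowerLevel 0 := by
  intro h hh A hA
  obtain ⟨C, N₀, H⟩ := H h hh A hA
  refine ⟨C, N₀, fun N hN w y hy => ?_⟩
  have hfloor : ⌊(N : ℝ) / Real.log N ^ (0 : ℝ)⌋₊ = N := by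
    rw [Real.rpow_zero, div_one, Nat.floor_natCast]
  rw [hfloor]
  exact H N hN w y hy

/-- **Level one is refuted**: `Σ_{q ≤ N} |…|` with `w ≡ 0`, `y q = q` is `ψ(N) ≥ N log 2 - log(N+1)`,
never `≪ N/log N`. [folklore] -/
theorem not_lambdaLiouvilleLevelOne : ¬ LambdaLiouvilleLevelOne := fun H =>
  not_lambdaLiouvilleLevelLogPowerLevel le_rfl (lambdaLiouvilleLevelLogPowerLevel_zero_of_levelOne H)

/-! ## Faces of the crux (consequences, for calibration; positive direction, hypothesis = crux)

The `q = 1` face (quantitative hybrid HLC(1,1)) is in the tree: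
`Theorems/LambdaLiouvilleLevel/Negative/LambdaLiouvilleLevelHLCFace.lean`. Here: the face in a
FIXED arithmetic progression — every modulus `q` is eventually below the level `N^{ε₀}`. -/

/-- **AP face.** The crux implies, for every modulus `q ≥ 1`, every residue `a` (coprime or not),
every shift `h ≠ 0` and every `A > 0`: `|Σ_{n ≤ N, n ≡ a (q)} Λ(n) λ(n+h)| ≤ C N/(log N)^A` for
`N ≥ N₀(h, A, q)` — quantitative hybrid Hardy–Littlewood–Chowla `(1,1)` in every fixed arithmetic
progression ("λ ⟂ shifted primes in progressions" with a log-power rate; open already at `q = 1`).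
Proof: keep the `q`-term of the modulus sum once `q ≤ N^{ε₀}`, i.e. `N ≥ q^{1/ε₀}`. [folklore] -/
theorem apFace_of_lambdaLiouvilleLevel (hL : LambdaLiouvilleLevel) (h : ℤ) (hh : h ≠ 0)
    (q a : ℕ) (hq : 1 ≤ q) (A : ℝ) (hA : 0 < A) :
    ∃ C : ℝ, ∃ N₀ : ℕ, ∀ N : ℕ, N₀ ≤ N →
      |∑ n ∈ (Icc 1 N).filter (fun n : ℕ => n ≡ a [MOD q]),
          vonMangoldt n * ((liouville (Int.toNat ((n : ℤ) + h)) : ℤ) : ℝ)| ≤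
        C * N / Real.log N ^ A := by
  obtain ⟨ε₀, hε₀, H⟩ := hL h hh
  obtain ⟨C, N₀, H⟩ := H A hA
  refine ⟨C, max N₀ ⌈(q : ℝ) ^ (1 / ε₀)⌉₊, fun N hN => ?_⟩
  have hN₀ : N₀ ≤ N := le_trans (le_max_left _ _) hN
  have hNq : (q : ℝ) ^ (1 / ε₀) ≤ N :=
    le_trans (Nat.le_ceil _) (by exact_mod_cast le_trans (le_max_right _ _) hN)
  have hqmem : q ∈ Icc 1 ⌊(N : ℝ) ^ ε₀⌋₊ := by
    rw [mem_Icc]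
    refine ⟨hq, Nat.le_floor ?_⟩
    have hq0 : (0 : ℝ) ≤ q := Nat.cast_nonneg q
    calc (q : ℝ) = ((q : ℝ) ^ (1 / ε₀)) ^ ε₀ := by
          rw [← Real.rpow_mul hq0, one_div_mul_cancel hε₀.ne', Real.rpow_one]
      _ ≤ (N : ℝ) ^ ε₀ := Real.rpow_le_rpow (Real.rpow_nonneg hq0 _) hNq hε₀.le
  have key := H N hN₀ (fun _ => a) (fun _ => N) (fun _ => le_rfl)
  have hle := Finset.single_le_sum
    (f := fun q' => |∑ n ∈ (Icc 1 N).filter (fun n : ℕ => n ≡ a [MOD q']),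
      vonMangoldt n * ((liouville (Int.toNat ((n : ℤ) + h)) : ℤ) : ℝ)|)
    (fun _ _ => abs_nonneg _) hqmem
  exact hle.trans key

/-! ## -- Targets
payload.targets = [] ; PICKED.md: no line picked (`Sketch` declared not a line). Nothing to attack in
cycle 1. When a skeleton `Lines/<slug>.lean` with `stub_*` is registered, its stubs go here. -/

end Summit.Parity.GeneralizedHardyLittlewood.Cruxes.LambdaLiouvilleLevel.Disproof
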